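import Summits.Ventures.PercRepro.C026CHubA
import Summits.Ventures.PercRepro.C026StarPrime

/-!
# Hub attachment and the D-free inequality, I: frozen configurations, hub states, clusters (p5, gen 10)

mine-3's dossier `proofs/MINE3-Q3-proof.md` §21.9 (M3-HUBV) proves the (★)-slack
`Δ(G) = #{bot : O1} + #{bot : O2} − #{bot : a ~_H b}` nonnegative for a graph whose `c`-neighbourhood is
«hubs plus one arbitrary vertex» by a pure COUNTING identity over the states of the hubs.  The heart of
that identity is independent of the arbitrary vertex: **attaching hubs to `c` never destroys the
D-free inequality**.  Here a *hub* is a non-mark vertex adjacent only to the marks (`IsHubLike`, p1's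
`C026HubFamilyExt.lean`); its edges may go to `a`, `b`, `c` with any multiplicities.

This file sets up the vocabulary:

* **`Frozen F ω`** — every edge of `F` is closed in `ω`; **`DFreeFrozen F a b c`** — the D-free
  inequality (H-graph form, `dFreeIneq_iff_hGraph`) restricted to the configurations with `F` closed
  (`F = ∅` is `DFreeIneq`: `dFreeIneq_iff_dFreeFrozen_empty`);
* **`baseOf Hs ω`** — `ω` with every edge at a hub closed (the *base* configuration);
* the **single-direction** condition **`SingleDir Hs ω`** (no hub has open edges to two different
  marks) and the **signature** of the hub states: **`SigA`** (some hub joins `c` to `K` through closed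
  edges: open `a`-edge and a closed `c`-edge, or a mixed `c`-star and an `a`-edge), **`SigB`**
  (symmetric), **`SigLink`** (a hub inside `M` with all its `c`-edges open and edges to both `a` and
  `b`: an H-link `K ~ L` that does not touch `c`);
* **`conn_iff_base`**: for single-direction `ω` and a non-hub `x`, the `ω`-cluster of `x` is its
  base cluster plus the hubs whose open edges go to a mark of that base cluster; in particular
  connectivity between non-hubs is base connectivity (`conn_iff_base'`), and
  **`isBot_iff_base`**: `ω ∈ bot ⟺ baseOf ω ∈ bot ∧ SingleDir ω`.
-/

namespace PercRepro

namespace MultiGraph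

variable {V E : Type*} {G : MultiGraph V E}

/-! ### Frozen configurations and the frozen D-free inequality -/

section Frozen

/-- Every edge of `F` is closed in `ω`. -/
def _root_.PercRepro.Frozen (F : Set E) (ω : Config E) : Prop := ∀ e ∈ F, ω e = false

/-- Nothing is frozen for `F = ∅`. -/
theorem _root_.PercRepro.frozen_empty (ω : Config E) : Frozen (∅ : Set E) ω := fun _ h => h.elim

variable (G) [Fintype E] [DecidableEq E]

open Classical in
/-- **The D-free inequality restricted to the configurations with `F` closed**, in mine-3's H-graph
form: `#{F-frozen bot : a ~_H b} ≤ #{F-frozen bot : c ~_H a avoiding L} + #{F-frozen bot : c ~_H b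
avoiding K}`.  For `F = ∅` this is `DFreeIneq` (`dFreeIneq_iff_dFreeFrozen_empty`). -/
def DFreeFrozen (F : Set E) (a b c : V) : Prop :=
  (Finset.univ.filter fun ω : Config E => Frozen F ω ∧ G.IsBot ω a b c ∧ G.HConn ω c a b).card ≤
    (Finset.univ.filter fun ω : Config E =>
      Frozen F ω ∧ G.IsBot ω a b c ∧ G.HConnAvoid ω c (G.cluster ω b) c a).card +
      (Finset.univ.filter fun ω : Config E =>
        Frozen F ω ∧ G.IsBot ω a b c ∧ G.HConnAvoid ω c (G.cluster ω a) c b).card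

open Classical in
/-- The frozen D-free inequality with nothing frozen is the D-free inequality. -/
theorem dFreeIneq_iff_dFreeFrozen_empty (a b c : V) :
    G.DFreeIneq a b c ↔ G.DFreeFrozen ∅ a b c := by
  rw [G.dFreeIneq_iff_hGraph]
  unfold DFreeFrozen
  simp only [frozen_empty, true_and]

end Frozen

/-! ### Hubs: the base configuration and the hub states -/

section Hubs

variable (G)

open Classical in
/-- The base configuration: `ω` with every edge at a hub closed. -/
noncomputable def baseOf (Hs : Set V) (ω : Config E) : Config E :=
  fun e => if e ∈ G.edgesAt Hs then false else ω e

/-- `h` has a closed edge to `y`. -/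
def ClosedTo (ω : Config E) (h y : V) : Prop := ∃ e, ω e = false ∧ G.Link e h y

/-- **Single direction**: no hub has open edges to two different marks (the hub condition for a `bot`
configuration). -/
def SingleDir (Hs : Set V) (a b c : V) (ω : Config E) : Prop :=
  ∀ h ∈ Hs, ¬ (G.OpenTo ω h a ∧ G.OpenTo ω h b) ∧ ¬ (G.OpenTo ω h a ∧ G.OpenTo ω h c) ∧
    ¬ (G.OpenTo ω h b ∧ G.OpenTo ω h c)

/-- **Signature bit for the mark `m` (`m = a` or `b`)**: some hub `h` outside `X` joins `c` to the
cluster of `m` through closed edges — `h` has an open `m`-edge and a closed `c`-edge (so `h ∈ Com_m`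
and `c – h` is an H-edge), or `h` has an open and a closed `c`-edge and an edge to `m` (so `h ∈ M`,
`c – h` is an internal H-edge and `h – m` an attachment). -/
def SigM (Hs : Set V) (X : Set V) (ω : Config E) (m c : V) : Prop :=
  ∃ h ∈ Hs, h ∉ X ∧ ((G.OpenTo ω h m ∧ G.ClosedTo ω h c) ∨
    (G.OpenTo ω h c ∧ G.ClosedTo ω h c ∧ G.HasEdge h m))

/-- **Link bit**: some hub outside `X` has all its `c`-edges open (at least one) and edges to both `a`
and `b` — an H-link `K ~ L` inside `M` that does not touch `c`. -/
def SigLink (Hs : Set V) (X : Set V) (ω : Config E) (a b c : V) : Prop :=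
  ∃ h ∈ Hs, h ∉ X ∧ G.OpenTo ω h c ∧ ¬ G.ClosedTo ω h c ∧ G.HasEdge h a ∧ G.HasEdge h b

variable {G}

/-- The base configuration is below `ω`. -/
theorem baseOf_le (Hs : Set V) (ω : Config E) : G.baseOf Hs ω ≤ ω := by
  intro e
  unfold baseOf
  split_ifs
  · exact Bool.false_le _
  · exact le_rfl

/-- The base configuration agrees with `ω` off the hub edges. -/
theorem baseOf_apply_of_notMem {Hs : Set V} (ω : Config E) {e : E} (he : e ∉ G.edgesAt Hs) :
    G.baseOf Hs ω e = ω e := by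
  simp [baseOf, he]

/-- The base configuration is closed on the hub edges. -/
theorem baseOf_apply_of_mem {Hs : Set V} (ω : Config E) {e : E} (he : e ∈ G.edgesAt Hs) :
    G.baseOf Hs ω e = false := by
  simp [baseOf, he]

/-- The base configuration is frozen on the hub edges. -/
theorem frozen_baseOf (Hs : Set V) (ω : Config E) : Frozen (G.edgesAt Hs) (G.baseOf Hs ω) :=
  fun _ he => baseOf_apply_of_mem ω he

/-- Freezing a set disjoint from the hub edges survives `baseOf`. -/
theorem frozen_baseOf_of_frozen {Hs : Set V} {F : Set E} {ω : Config E} (hF : Frozen F ω) :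
    Frozen F (G.baseOf Hs ω) := by
  intro e he
  unfold baseOf
  split_ifs
  · rfl
  · exact hF e he

/-- `baseOf` is idempotent. -/
theorem baseOf_baseOf (Hs : Set V) (ω : Config E) : G.baseOf Hs (G.baseOf Hs ω) = G.baseOf Hs ω := by
  funext e
  by_cases he : e ∈ G.edgesAt Hs
  · simp [baseOf, he]
  · simp [baseOf, he]

/-- A configuration frozen on the hub edges is its own base. -/
theorem baseOf_eq_self {Hs : Set V} {ω : Config E} (h : Frozen (G.edgesAt Hs) ω) :
    G.baseOf Hs ω = ω := by
  funext e
  by_cases he : e ∈ G.edgesAt Hs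
  · rw [baseOf_apply_of_mem ω he, h e he]
  · exact baseOf_apply_of_notMem ω he

/-- An edge joining two vertices outside `Hs` is not a hub edge. -/
theorem notMem_edgesAt_of_link {Hs : Set V} {e : E} {u v : V} (hl : G.Link e u v) (hu : u ∉ Hs)
    (hv : v ∉ Hs) : e ∉ G.edgesAt Hs := by
  rw [hl.mem_edgesAt_iff]
  rintro (h | h)
  · exact hu h
  · exact hv h

/-- An open edge of the base is open in `ω`. -/
theorem baseOf_eq_true_iff {Hs : Set V} (ω : Config E) {e : E} (he : e ∉ G.edgesAt Hs) :
    G.baseOf Hs ω e = true ↔ ω e = true := by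
  rw [baseOf_apply_of_notMem ω he]

/-- `OpenTo` is determined by `ω` on the hub edges only: for a hub `h` it is unchanged by closing the
other hubs' edges — stated as monotonicity here. -/
theorem OpenTo.mono {ω ω' : Config E} (h : ω ≤ ω') {x y : V} (hxy : G.OpenTo ω x y) :
    G.OpenTo ω' x y := by
  obtain ⟨e, he, hl⟩ := hxy
  exact ⟨e, Bool.le_iff_imp.1 (h e) he, hl⟩

end Hubs

/-! ### The clusters of a single-direction configuration -/

section Clusters

variable {Hs : Set V} {a b c : V}

/-- The hub hypothesis: every vertex of `Hs` is a non-mark adjacent only to marks. -/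
def IsHubSet (G : MultiGraph V E) (Hs : Set V) (a b c : V) : Prop :=
  ∀ h ∈ Hs, G.IsHubLike a b c h ∧ IsHubV a b c h

variable (hH : G.IsHubSet Hs a b c)
include hH

/-- Marks are not hubs. -/
theorem IsHubSet.mark_notMem {m : V} (hm : m = a ∨ m = b ∨ m = c) : m ∉ Hs := by
  intro hmem
  obtain ⟨-, h1, h2, h3⟩ := hH m hmem
  rcases hm with rfl | rfl | rfl
  · exact h1 rfl
  · exact h2 rfl
  · exact h3 rfl

/-- The other endpoint of an edge at a hub is a mark. -/
theorem IsHubSet.mark_of_link {h : V} (hh : h ∈ Hs) {e : E} {y : V} (hl : G.Link e h y) :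
    y = a ∨ y = b ∨ y = c :=
  (hH h hh).1.mark_of_link hl

/-- An edge at a hub joins it to a mark: a hub edge has a hub endpoint and a mark endpoint. -/
theorem IsHubSet.link_of_mem_edgesAt {e : E} (he : e ∈ G.edgesAt Hs) :
    ∃ h ∈ Hs, ∃ m, (m = a ∨ m = b ∨ m = c) ∧ G.Link e h m := by
  rcases he with he | he
  · exact ⟨G.fst e, he, G.snd e, hH.mark_of_link he (Or.inl ⟨rfl, rfl⟩), Or.inl ⟨rfl, rfl⟩⟩
  · exact ⟨G.snd e, he, G.fst e, hH.mark_of_link he (Or.inr ⟨rfl, rfl⟩), Or.inr ⟨rfl, rfl⟩⟩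

/-- A hub is joined to a mark `m` by an open edge iff it is open to `m` (definition unfolding with
the hub's edges all going to marks). -/
theorem IsHubSet.openTo_mark_of_open {h : V} (hh : h ∈ Hs) {ω : Config E} {e : E} (he : ω e = true)
    {y : V} (hl : G.Link e h y) : G.OpenTo ω h y ∧ (y = a ∨ y = b ∨ y = c) :=
  ⟨⟨e, he, hl⟩, hH.mark_of_link hh hl⟩

/-- **The cluster of a non-hub in a single-direction configuration**: `z` is connected to `x` iff
`z` is a non-hub connected to `x` in the base, or `z` is a hub with an open edge to a mark connected
to `x` in the base. -/
theorem IsHubSet.conn_iff_base {ω : Config E} (hsd : G.SingleDir Hs a b c ω) {x : V}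
    (hx : x ∉ Hs) (z : V) :
    G.Conn ω x z ↔
      (z ∉ Hs ∧ G.Conn (G.baseOf Hs ω) x z) ∨
        (z ∈ Hs ∧ ∃ m, (m = a ∨ m = b ∨ m = c) ∧ G.OpenTo ω z m ∧ G.Conn (G.baseOf Hs ω) x m) := by
  set β := G.baseOf Hs ω with hβ
  -- the candidate cluster `X` has closed boundary in `ω`
  let X : Set V := {z | (z ∉ Hs ∧ G.Conn β x z) ∨
    (z ∈ Hs ∧ ∃ m, (m = a ∨ m = b ∨ m = c) ∧ G.OpenTo ω z m ∧ G.Conn β x m)}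
  have hXcl : ∀ e, ω e = true → (G.fst e ∈ X ↔ G.snd e ∈ X) := by
    intro e he
    by_cases hmem : e ∈ G.edgesAt Hs
    · -- a hub edge joins a hub `h` to a mark `m`; `h ∈ X ↔ m ∈ X` by single direction
      obtain ⟨h, hh, m, hm, hl⟩ := hH.link_of_mem_edgesAt hmem
      have hmH : m ∉ Hs := hH.mark_notMem hm
      have key : h ∈ X ↔ m ∈ X := by
        constructor
        · rintro (⟨hhH, -⟩ | ⟨-, m', hm', hopen', hconn'⟩)
          · exact (hhH hh).elim
          · -- `h` is open to `m'` and to `m`; single direction forces `m' = m`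
            have hopen : G.OpenTo ω h m := ⟨e, he, hl⟩
            have hmm : m' = m := by
              obtain ⟨h1, h2, h3⟩ := hsd h hh
              rcases hm' with rfl | rfl | rfl <;> rcases hm with rfl | rfl | rfl
              · rfl
              · exact (h1 ⟨hopen', hopen⟩).elim
              · exact (h2 ⟨hopen', hopen⟩).elim
              · exact (h1 ⟨hopen, hopen'⟩).elim
              · rfl
              · exact (h3 ⟨hopen', hopen⟩).elim
              · exact (h2 ⟨hopen, hopen'⟩).elim
              · exact (h3 ⟨hopen, hopen'⟩).elim
              · rfl
            exact Or.inl ⟨hmH, hmm ▸ hconn'⟩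
        · rintro (⟨-, hconn⟩ | ⟨hmH', -⟩)
          · exact Or.inr ⟨hh, m, hm, ⟨e, he, hl⟩, hconn⟩
          · exact (hmH hmH').elim
      rcases hl with ⟨h1, h2⟩ | ⟨h1, h2⟩
      · rw [h1, h2]; exact key
      · rw [h1, h2]; exact key.symm
    · -- a non-hub edge, open in the base too: both endpoints are non-hubs
      have hβe : β e = true := by rw [hβ, baseOf_apply_of_notMem ω hmem]; exact he
      have hf : G.fst e ∉ Hs := fun h => hmem (Or.inl h)
      have hs : G.snd e ∉ Hs := fun h => hmem (Or.inr h)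
      have hc : G.Conn β (G.fst e) (G.snd e) := Conn.of_openAdj (G.openAdj_of_open e hβe)
      constructor
      · rintro (⟨-, h⟩ | ⟨h, -⟩)
        · exact Or.inl ⟨hs, h.trans hc⟩
        · exact (hf h).elim
      · rintro (⟨-, h⟩ | ⟨h, -⟩)
        · exact Or.inl ⟨hf, h.trans hc.symm⟩
        · exact (hs h).elim
  constructor
  · intro hxz
    have hxX : x ∈ X := Or.inl ⟨hx, Conn.refl G β x⟩
    exact G.mem_of_conn_of_closed_boundary hXcl hxX hxz
  · rintro (⟨-, h⟩ | ⟨-, m, -, hopen, hconn⟩)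
    · exact h.mono (baseOf_le Hs ω)
    · exact (hconn.mono (baseOf_le Hs ω)).trans hopen.conn.symm

/-- Connectivity between non-hubs is base connectivity. -/
theorem IsHubSet.conn_iff_base' {ω : Config E} (hsd : G.SingleDir Hs a b c ω) {x z : V}
    (hx : x ∉ Hs) (hz : z ∉ Hs) : G.Conn ω x z ↔ G.Conn (G.baseOf Hs ω) x z := by
  rw [hH.conn_iff_base hsd hx z]
  constructor
  · rintro (⟨-, h⟩ | ⟨h, -⟩)
    · exact h
    · exact (hz h).elim
  · intro h
    exact Or.inl ⟨hz, h⟩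

omit hH in
/-- A `bot` configuration is single-direction. -/
theorem IsBot.singleDir {ω : Config E} (hbot : G.IsBot ω a b c) : G.SingleDir Hs a b c ω := by
  intro h _
  refine ⟨fun ⟨h1, h2⟩ => hbot.1 (h1.conn.symm.trans h2.conn),
    fun ⟨h1, h2⟩ => hbot.2.1 (h1.conn.symm.trans h2.conn),
    fun ⟨h1, h2⟩ => hbot.2.2 (h1.conn.symm.trans h2.conn)⟩

/-- **`bot` decomposes**: `ω ∈ bot ⟺ baseOf ω ∈ bot ∧ ω single-direction`. -/
theorem IsHubSet.isBot_iff_base (ω : Config E) :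
    G.IsBot ω a b c ↔ G.IsBot (G.baseOf Hs ω) a b c ∧ G.SingleDir Hs a b c ω := by
  constructor
  · intro hbot
    refine ⟨⟨fun h => hbot.1 (h.mono (baseOf_le Hs ω)), fun h => hbot.2.1 (h.mono (baseOf_le Hs ω)),
      fun h => hbot.2.2 (h.mono (baseOf_le Hs ω))⟩, hbot.singleDir⟩
  · rintro ⟨hbot, hsd⟩
    have ha : a ∉ Hs := hH.mark_notMem (Or.inl rfl)
    have hb : b ∉ Hs := hH.mark_notMem (Or.inr (Or.inl rfl))
    have hc : c ∉ Hs := hH.mark_notMem (Or.inr (Or.inr rfl))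
    refine ⟨fun h => hbot.1 ((hH.conn_iff_base' hsd ha hb).1 h),
      fun h => hbot.2.1 ((hH.conn_iff_base' hsd ha hc).1 h),
      fun h => hbot.2.2 ((hH.conn_iff_base' hsd hb hc).1 h)⟩

/-- In `bot`, a hub lies in the cluster of the mark `m` iff it is open to `m`. -/
theorem IsHubSet.hub_conn_mark_iff {ω : Config E} (hbot : G.IsBot ω a b c) {h : V} (hh : h ∈ Hs)
    {m : V} (hm : m = a ∨ m = b ∨ m = c) : G.Conn ω m h ↔ G.OpenTo ω h m := by
  have hmH : m ∉ Hs := hH.mark_notMem hm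
  rw [hH.conn_iff_base hbot.singleDir hmH h]
  have hbotβ : G.IsBot (G.baseOf Hs ω) a b c := ((hH.isBot_iff_base ω).1 hbot).1
  constructor
  · rintro (⟨hhH, -⟩ | ⟨-, m', hm', hopen, hconn⟩)
    · exact (hhH hh).elim
    · rwa [hbotβ.eq_of_conn_marks hm hm' hconn] at *
  · intro hopen
    exact Or.inr ⟨hh, m, hm, hopen, Conn.refl _ _ _⟩

/-- In `bot`, a non-hub lies in the cluster of the mark `m` iff it does so in the base. -/
theorem IsHubSet.nonhub_conn_mark_iff {ω : Config E} (hbot : G.IsBot ω a b c) {z : V} (hz : z ∉ Hs)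
    {m : V} (hm : m = a ∨ m = b ∨ m = c) : G.Conn ω m z ↔ G.Conn (G.baseOf Hs ω) m z :=
  hH.conn_iff_base' hbot.singleDir (hH.mark_notMem hm) hz

/-- A hub with no open edge is isolated. -/
theorem IsHubSet.conn_hub_of_noOpen {ω : Config E} {h : V} (hh : h ∈ Hs)
    (hno : ¬ G.OpenTo ω h a) (hnb : ¬ G.OpenTo ω h b) (hnc : ¬ G.OpenTo ω h c) {y : V}
    (hconn : G.Conn ω h y) : y = h :=
  (hH h hh).1.eq_of_conn_of_noOpen ⟨hno, hnb, hnc⟩ hconn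

end Clusters

end MultiGraph

end PercRepro
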